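import Summits.KontsevichZagierPeriods.KontsevichZagierPeriods.Theorems.SymplecticScissorsRealOnePeriodRelationsStubCells
import Summits.KontsevichZagierPeriods.KontsevichZagierPeriods.Theorems.SymplecticScissorsRealOnePeriodRelationsStubArcSymbols
import Summits.KontsevichZagierPeriods.KontsevichZagierPeriods.Theorems.SymplecticScissorsRealOnePeriodRelationsStubNormalisationGlue

/-!
# `RealOnePeriodRelations` (stmt-KontsevichZagierPeriods-10042), line `nash-retraction-thin-strip`:
# stub `stub_normalisation` (Ψ) — closed from `stub_cells`, `stub_arcSymbols` and the glue

The registered stub `stub_normalisation` of the lead skeleton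
`Cruxes/RealOnePeriodRelations/Lines/nash-retraction-thin-strip.lean` (reshape 2c): every `c ∈ H₁` is, modulo
`M₁`, a finite algebraic combination of real realisations of period symbols of curve type along `ℚ`-semialgebraic
paths, with the same evaluation.  It is the composition `NormalisationGlue.normalisation_of stub_cells stub_arcSymbols`
of the three landed pieces: cell decomposition (`stub_cells`), arcs-are-symbols (`stub_arcSymbols`, through the real
Puiseux germ) and the bookkeeping glue.  [cite: HuberWustholz2022, §3.3.1 and Thm 13.3 (2)]
[cite: KontsevichZagier2001, §1.2]
-/

noncomputable section

open scoped BigOperators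
open Set MeasureTheory
open Literature.NumberTheory.Transcendental Literature.NumberTheory.Transcendental.CurvePeriods
open Literature.ModelTheory.ExponentialFields (IsSemialgebraic)
open Summit.KontsevichZagierPeriods.SymplecticScissors.RealOnePeriodRelationsNegative (M₁ H₁)

namespace Summit.KontsevichZagierPeriods.SymplecticScissors.RealOnePeriodRelations

/-- **Stub `stub_normalisation` (Ψ).** Every `c ∈ H₁` is, modulo `M₁`, a finite sum `Σ_s [R s]` of real
realisations `R s` of period symbols `s` of curve type (algebraic coefficients `C s`, `ℚ`-semialgebraic symbol
paths) with `evalCombination C = eval c`. [cite: HuberWustholz2022, §3.3.1 and Thm 13.3 (2)] -/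
theorem stub_normalisation : ∀ c : KZ.FormalRep, c ∈ H₁ →
    ∃ (C : PeriodSymbol →₀ ℂ) (R : PeriodSymbol → KZ.IntegralRep 1), (∀ s, IsAlgebraic ℚ (C s)) ∧
      (∀ s ∈ C.support, IsSemialgebraicMapOn ℚ {z : Fin 1 → ℝ | z 0 ∈ Set.Icc (0 : ℝ) 1}
        (fun z => Fin.append (fun i => (s.γ.toFun (z 0) i).re) (fun i => (s.γ.toFun (z 0) i).im))) ∧
      (∀ s ∈ C.support, (R s).domain = {z | z 0 ∈ Set.Ioo (0 : ℝ) 1} ∧ ∀ z ∈ (R s).domain, (R s).integrand z =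
        (C s * ∑ i, MvPolynomial.eval (s.γ.toFun (z 0)) (s.ω i) * deriv (fun u => s.γ.toFun u i) (z 0)).re) ∧
      evalCombination C = ((KZ.eval c : ℝ) : ℂ) ∧ c - ∑ s ∈ C.support, KZ.of (R s) ∈ M₁ :=
  NormalisationGlue.normalisation_of stub_cells stub_arcSymbols

end Summit.KontsevichZagierPeriods.SymplecticScissors.RealOnePeriodRelations

end
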